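import Summits.QuantumFields.YangMills.Theorems.BalabanUVNodesN15KingModelCurvatureCycle
import Summits.QuantumFields.YangMills.Theorems.BalabanUVNodesN15KingModelCovariantSpectralBounds
import Summits.QuantumFields.YangMills.Theorems.BalabanUVNodesN15KingModelCoverBoundary
import HarnessLib

/-!
# BalabanUVNodes ∕ N15 — THE KING-MODEL RUNG (PART Ϳ-b): PLAQUETTE COERCIVITY — at EVERY unitary link field `U` on King's torus (any fibre `𝕜ⁿ`, non-abelian), uniformly non-flat
# `(ν₀,ν₁)`-plaquettes (`Re⟪u, P_U(x,ν₀,ν₁)u⟫ ≤ γ‖u‖²`) give `Re⟨v,(−cΔ_U+m²)v⟩ ≥ (m² + 2c·λ(γ))‖v‖²`, and all orientations give `m² + (d+1)c·λ(γ)`: CURVATURE BOUNDED BELOW IS A MASS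
# (Track A, DAG node N15 = NE2; FAN-OUT v1.1 §N15 s3 «KING-MODEL RUNG … + what the curved case adds»; count-neutral)

HONEST FRAMING.  Count-neutral (cell `pub-ymgap`, seat `pub-ymgap-dag-n15-e` g46; `--supports stmt-QuantumFields-27247 --as helper` = K3ᴬ, KEY MAP v3).  King's fine covariance layer
`−cΔ_U + m²` (PART Ͱ-a `covLapF`, [Balaban1985BackgroundPropagators] (3.23), [King1986] (4.4)) at an arbitrary unitary link field on ONE finite torus; elementary form inequalities; NOT
Bałaban's `G_k(U)` (no block term), NOT [Balaban1985BackgroundPropagators] (3.42); NOT a node discharge (N15 of record untouched); nothing continuum ∕ ℝ⁴ ∕ OS ∕ Clay.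

THE RESULTS (`K` any period vector, `c ≥ 0`, `m² ∈ ℝ`, fibre `𝕜ⁿ`, `U` unitary; `λ = plaqGap` of Ϳ-a; `P_U(x,μ,ν) = U(x,μ)U(x+e_μ,ν)U(x+e_ν,μ)^*U(x,ν)^*` = Ͻ-q `kingPlaq`):
* §1 `unitaryIso` (a unitary matrix as a linear isometry of `EuclideanSpace 𝕜 n`), `bondE`∕`plaqE` (the covariant bond and plaquette energies `‖v_x − U(x,μ)v_{x+e_μ}‖²`), `norm_sub_conjTranspose_apply`
  (`‖p − W^*q‖ = ‖q − Wp‖`), ★★ **`plaqE_ge`** — ONE PLAQUETTE: `λ(γ)·(‖v_x‖²+‖v_{x+e_μ}‖²+‖v_{x+e_μ+e_ν}‖²+‖v_{x+e_ν}‖²) ≤ plaqE` whenever `Re⟪u, P_U(x,μ,ν)u⟫ ≤ γ‖u‖²` (Ϳ-a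
  `twisted_cycle_four_ge_links` with the transporters `U(x,μ), U(x+e_μ,ν), U(x+e_ν,μ)^*, U(x,ν)^*`, whose product IS `P_U`);
* §2 the bookkeeping on the torus: `sum_plaqE_eq` (`Σ_x plaqE(x,μ,ν) = 2Σ_x bondE(x,μ) + 2Σ_x bondE(x,ν)` — every bond lies in two plaquettes of a given orientation, translations are
  bijections), `sum_corner_mass_eq` (`Σ_x(corner masses) = 4‖v‖²`), `re_quadForm_covLapF_eq_bondE` (Ͱ-d's Dirichlet form in this file's letters);
* §3 ★★★ **`re_quadForm_covLapF_ge_plaq`** — for `ν₀ ≠ ν₁` and `Re⟪u,P_U(x,ν₀,ν₁)u⟫ ≤ γ‖u‖²` at every site: `(m² + 2c·λ(γ))·Σ_x‖v_x‖² ≤ Re⟨v, (−cΔ_U+m²)v⟩`; ★★★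
  **`re_quadForm_covLapF_ge_plaq_all`** — the bound at ALL ordered pairs `μ ≠ ν` gives `(m² + (d+1)c·λ(γ))` (`d ≥ 1`; each direction lies in `2d` ordered pairs);
* §4 corollaries in spectral language: ★★ `eigenvalues_covLapF_ge_plaq` (every eigenvalue `≥ m² + 2cλ(γ)`), ★★ `posDef_covLapF_of_plaq` (`m² + 2cλ(γ) > 0` ⟹ `M_U ≻ 0` — in particular the
  MASSLESS `−cΔ_U` is invertible at every field with uniformly non-flat plaquettes, `γ < 1`), `isUnit_covLapF_of_plaq`, ★★★ **`norm_toLp_inv_mulVec_le_of_plaq`** ∕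
  **`l2_opNorm_covLapF_inv_le_of_plaq`** (`‖(−cΔ_U+m²)⁻¹‖_{ℓ²→ℓ²} ≤ (m² + 2cλ(γ))⁻¹`, uniformly in the volume and in `U` within the class).
WHAT THE CURVED CASE ADDS (as theorems): PART Ͱ-d∕Ͱ-f said `λ_min(−cΔ_U) ≥ 0` with equality iff pure gauge, [DodziukMathai2006] Cor 1.3 `λ₀(Δ) ≤ λ₀(Δ_σ)`; here the gain is QUANTIFIED
LOCALLY: plaquette angle `θ` everywhere in one orientation ⟹ `λ_min(−cΔ_U) ≥ 2c(2−2cos(θ∕4)) ≥ cθ²∕(2π²)` — a mass of order `c·θ²` generated by curvature, sharp at π-flux (Ϳ-d); in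
Bałaban's regular regime (`θ = O(η²)`, `c = η⁻²`) this is `O(η²)`: no uniform mass from small fields (honest: the plaquette road is the strong-curvature road).
PRIOR TREE ART (by name, not restated): Ϳ-a (`plaqGap`, `twisted_cycle_four_ge_links`), Ͱ-a (`covLapF`, `isHermitian_covLapF`), Ͱ-b (`fib`, `norm_toEuclideanLin_of_mem_unitaryGroup`), Ͱ-d
(`re_quadForm_covLapF`, `im_quadForm_covLapF`), Ͱ-f (`sum_norm_fib_sq`, `re_star_dotProduct_le_norm_mul_norm`), Ͻ-q (`kingPlaq`), Mathlib (`Matrix.toEuclideanLin`, `PosDef.of_dotProduct_mulVec_pos`,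
`IsHermitian.eigenvalues_eq`, `Matrix.cstar_norm_def`).  Dedup (rg at filing): basename 0 files; needles `unitaryIso|bondE|plaqE|plaqE_ge|re_quadForm_covLapF_ge_plaq|l2_opNorm_covLapF_inv_le_of_plaq` 0 tree files.
Locators: [DodziukMathai2006] §1 Lemma 1.2 ∕ Cor 1.3; [Balaban1985BackgroundPropagators] (3.3) p.391, (3.23) p.394; [King1986] (2.12) p.653, (4.4) p.670.  0 `sorry`, 3 `def`.
-/

noncomputable section
open scoped BigOperators ComplexConjugate ComplexOrder InnerProductSpace
open Finset Matrix WithLp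

namespace Summit.QuantumFields.YangMills.BalabanUVNodes.N15KingModelRung.Curvature

open Literature.MathematicalPhysics.QuantumFieldTheory.Balaban1983to89.B5Prop11Plancherel (Tor unitVec)
open Summit.QuantumFields.YangMills.BalabanUVNodes.N15KingModelRung.Covariant
  (covLapF fib fib_apply norm_toEuclideanLin_of_mem_unitaryGroup re_quadForm_covLapF im_quadForm_covLapF isHermitian_covLapF sum_norm_fib_sq re_star_dotProduct_le_norm_mul_norm)
open Summit.QuantumFields.YangMills.BalabanUVNodes.N15KingModelRung.Cover (kingPlaq)

variable {d : ℕ} (K : Fin (d + 1) → ℕ)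
variable {𝕜 : Type*} [RCLike 𝕜] {n : Type*} [Fintype n] [DecidableEq n]

/-! ## §1 One plaquette -/

section One

/-- A UNITARY MATRIX AS A LINEAR ISOMETRY of `EuclideanSpace 𝕜 n` (Ͱ-b `norm_toEuclideanLin_of_mem_unitaryGroup`). [folklore] -/
def unitaryIso {W : Matrix n n 𝕜} (hW : W ∈ Matrix.unitaryGroup n 𝕜) : EuclideanSpace 𝕜 n →ₗᵢ[𝕜] EuclideanSpace 𝕜 n where
  toLinearMap := Matrix.toEuclideanLin W
  norm_map' := norm_toEuclideanLin_of_mem_unitaryGroup hW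

/-- `unitaryIso W u = toEuclideanLin W u`. [folklore] -/
@[simp] theorem unitaryIso_apply {W : Matrix n n 𝕜} (hW : W ∈ Matrix.unitaryGroup n 𝕜) (u : EuclideanSpace 𝕜 n) : unitaryIso hW u = Matrix.toEuclideanLin W u := rfl

/-- `toEuclideanLin (A·B) = toEuclideanLin A ∘ toEuclideanLin B` pointwise. [folklore] -/
theorem toEuclideanLin_mul_apply (A B : Matrix n n 𝕜) (u : EuclideanSpace 𝕜 n) :
    Matrix.toEuclideanLin (A * B) u = Matrix.toEuclideanLin A (Matrix.toEuclideanLin B u) := by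
  rw [Matrix.toLpLin_apply, Matrix.toLpLin_apply, Matrix.toLpLin_apply, ofLp_toLp, Matrix.mulVec_mulVec]

/-- `‖p − W^*q‖ = ‖q − Wp‖` for unitary `W` (apply the isometry `W`: `W(p − W^*q) = Wp − q`). [folklore] -/
theorem norm_sub_conjTranspose_apply {W : Matrix n n 𝕜} (hW : W ∈ Matrix.unitaryGroup n 𝕜) (p q : EuclideanSpace 𝕜 n) :
    ‖p - Matrix.toEuclideanLin Wᴴ q‖ = ‖q - Matrix.toEuclideanLin W p‖ := by
  have hWW : W * Wᴴ = 1 := by simpa only [star_eq_conjTranspose] using Matrix.mem_unitaryGroup_iff.mp hW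
  have h1 : Matrix.toEuclideanLin (1 : Matrix n n 𝕜) q = q := by rw [Matrix.toLpLin_apply, Matrix.one_mulVec]
  rw [← norm_toEuclideanLin_of_mem_unitaryGroup hW (p - Matrix.toEuclideanLin Wᴴ q), map_sub, ← toEuclideanLin_mul_apply, hWW, ← norm_neg, neg_sub, h1]

/-- THE COVARIANT BOND ENERGY `‖v_x − U(x,μ)v_{x+e_μ}‖²` of the bond `(x,μ)` (the summand of PART Ͱ-d's Dirichlet form). [cite: Balaban1985BackgroundPropagators, (3.3) p.391, (3.23) p.394] -/
def bondE (U : Tor K × Fin (d + 1) → Matrix n n 𝕜) (v : Tor K × n → 𝕜) (x : Tor K) (μ : Fin (d + 1)) : ℝ :=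
  ‖fib K v x - Matrix.toEuclideanLin (U (x, μ)) (fib K v (x + unitVec K μ))‖ ^ 2

/-- THE PLAQUETTE ENERGY: the four bond energies around the plaquette at `x` in the `(μ,ν)` plane (corners `x, x+e_μ, x+e_μ+e_ν, x+e_ν`). [cite: King1986, (2.12) p.653] -/
def plaqE (U : Tor K × Fin (d + 1) → Matrix n n 𝕜) (v : Tor K × n → 𝕜) (x : Tor K) (μ ν : Fin (d + 1)) : ℝ :=
  bondE K U v x μ + bondE K U v (x + unitVec K μ) ν + bondE K U v (x + unitVec K ν) μ + bondE K U v x ν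

/-- `bondE ≥ 0`. [folklore] -/
theorem bondE_nonneg (U : Tor K × Fin (d + 1) → Matrix n n 𝕜) (v : Tor K × n → 𝕜) (x : Tor K) (μ : Fin (d + 1)) : 0 ≤ bondE K U v x μ := sq_nonneg _

/-- ★★ **ONE PLAQUETTE**: if the holonomy `P_U(x,μ,ν)` has numerical range in `Re ≤ γ`, then `λ(γ)·(‖v_x‖²+‖v_{x+e_μ}‖²+‖v_{x+e_μ+e_ν}‖²+‖v_{x+e_ν}‖²) ≤ plaqE(x,μ,ν)` — the four covariant
differences around a non-flat plaquette cannot all be small (Ϳ-a with transporters `U(x,μ), U(x+e_μ,ν), U(x+e_ν,μ)^*, U(x,ν)^*`, product `= P_U`).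
[cite: DodziukMathai2006, Cor 1.3 §1; King1986, (2.12) p.653; Balaban1985BackgroundPropagators, (3.23) p.394] -/
theorem plaqE_ge {U : Tor K × Fin (d + 1) → Matrix n n 𝕜} (hU : ∀ b, U b ∈ Matrix.unitaryGroup n 𝕜) (v : Tor K × n → 𝕜) (x : Tor K) (μ ν : Fin (d + 1)) {γ : ℝ}
    (hγ : ∀ u : EuclideanSpace 𝕜 n, RCLike.re ⟪u, Matrix.toEuclideanLin (kingPlaq K U x μ ν) u⟫_𝕜 ≤ γ * ‖u‖ ^ 2) :
    plaqGap γ * (‖fib K v x‖ ^ 2 + ‖fib K v (x + unitVec K μ)‖ ^ 2 + ‖fib K v (x + unitVec K μ + unitVec K ν)‖ ^ 2 + ‖fib K v (x + unitVec K ν)‖ ^ 2)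
      ≤ plaqE K U v x μ ν := by
  have h1 : (U (x + unitVec K ν, μ))ᴴ ∈ Matrix.unitaryGroup n 𝕜 := by simpa only [star_eq_conjTranspose] using Unitary.star_mem (hU _)
  have h2 : (U (x, ν))ᴴ ∈ Matrix.unitaryGroup n 𝕜 := by simpa only [star_eq_conjTranspose] using Unitary.star_mem (hU _)
  have hcomp : ∀ u : EuclideanSpace 𝕜 n,
      ((unitaryIso (hU (x, μ))).comp ((unitaryIso (hU (x + unitVec K μ, ν))).comp ((unitaryIso h1).comp (unitaryIso h2)))) u
        = Matrix.toEuclideanLin (kingPlaq K U x μ ν) u := fun u => by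
    simp only [LinearIsometry.coe_comp, Function.comp_apply, unitaryIso_apply, kingPlaq, toEuclideanLin_mul_apply]
  have h := twisted_cycle_four_ge_links (unitaryIso (hU (x, μ))) (unitaryIso (hU (x + unitVec K μ, ν))) (unitaryIso h1) (unitaryIso h2) (γ := γ)
    (fun u => by rw [hcomp u]; exact hγ u) (fib K v x) (fib K v (x + unitVec K μ)) (fib K v (x + unitVec K μ + unitVec K ν)) (fib K v (x + unitVec K ν))
  simp only [unitaryIso_apply] at h
  have e3 : ‖fib K v (x + unitVec K μ + unitVec K ν) - Matrix.toEuclideanLin (U (x + unitVec K ν, μ))ᴴ (fib K v (x + unitVec K ν))‖ ^ 2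
      = bondE K U v (x + unitVec K ν) μ := by
    rw [norm_sub_conjTranspose_apply (hU _), bondE, add_right_comm]
  have e4 : ‖fib K v (x + unitVec K ν) - Matrix.toEuclideanLin (U (x, ν))ᴴ (fib K v x)‖ ^ 2 = bondE K U v x ν := by
    rw [norm_sub_conjTranspose_apply (hU _), bondE]
  rw [e3, e4] at h
  unfold plaqE
  rw [show bondE K U v x μ = ‖fib K v x - Matrix.toEuclideanLin (U (x, μ)) (fib K v (x + unitVec K μ))‖ ^ 2 from rfl,
    show bondE K U v (x + unitVec K μ) ν = ‖fib K v (x + unitVec K μ) - Matrix.toEuclideanLin (U (x + unitVec K μ, ν)) (fib K v (x + unitVec K μ + unitVec K ν))‖ ^ 2 from rfl]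
  exact h

end One

/-! ## §2 Bookkeeping on the torus -/

section Sums

variable [hK : ∀ μ, NeZero (K μ)]

/-- **EVERY BOND LIES IN TWO PLAQUETTES OF A GIVEN ORIENTATION**: `Σ_x plaqE(x,μ,ν) = 2Σ_x bondE(x,μ) + 2Σ_x bondE(x,ν)` (reindex `x ↦ x + e_ν`, `x ↦ x + e_μ`, bijections of the torus).
[cite: King1986, (2.12) p.653] -/
theorem sum_plaqE_eq (U : Tor K × Fin (d + 1) → Matrix n n 𝕜) (v : Tor K × n → 𝕜) (μ ν : Fin (d + 1)) :
    ∑ x, plaqE K U v x μ ν = 2 * ∑ x, bondE K U v x μ + 2 * ∑ x, bondE K U v x ν := by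
  simp only [plaqE, Finset.sum_add_distrib]
  have hμ : ∑ x, bondE K U v (x + unitVec K μ) ν = ∑ x, bondE K U v x ν :=
    Fintype.sum_equiv (Equiv.addRight (unitVec K μ)) _ _ fun _ => rfl
  have hν : ∑ x, bondE K U v (x + unitVec K ν) μ = ∑ x, bondE K U v x μ :=
    Fintype.sum_equiv (Equiv.addRight (unitVec K ν)) _ _ fun _ => rfl
  rw [hμ, hν]; ring

omit [DecidableEq n] in
/-- `Σ_x(‖v_x‖²+‖v_{x+e_μ}‖²+‖v_{x+e_μ+e_ν}‖²+‖v_{x+e_ν}‖²) = 4·Σ_x‖v_x‖²` (each corner sum is a translate). [folklore] -/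
theorem sum_corner_mass_eq (v : Tor K × n → 𝕜) (μ ν : Fin (d + 1)) :
    ∑ x, (‖fib K v x‖ ^ 2 + ‖fib K v (x + unitVec K μ)‖ ^ 2 + ‖fib K v (x + unitVec K μ + unitVec K ν)‖ ^ 2 + ‖fib K v (x + unitVec K ν)‖ ^ 2)
      = 4 * ∑ x, ‖fib K v x‖ ^ 2 := by
  simp only [Finset.sum_add_distrib]
  have h1 : ∑ x, ‖fib K v (x + unitVec K μ)‖ ^ 2 = ∑ x, ‖fib K v x‖ ^ 2 := Fintype.sum_equiv (Equiv.addRight (unitVec K μ)) _ _ fun _ => rfl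
  have h2 : ∑ x, ‖fib K v (x + unitVec K μ + unitVec K ν)‖ ^ 2 = ∑ x, ‖fib K v x‖ ^ 2 :=
    Fintype.sum_equiv (Equiv.addRight (unitVec K μ + unitVec K ν)) _ _ fun x => by simp [add_assoc]
  have h3 : ∑ x, ‖fib K v (x + unitVec K ν)‖ ^ 2 = ∑ x, ‖fib K v x‖ ^ 2 := Fintype.sum_equiv (Equiv.addRight (unitVec K ν)) _ _ fun _ => rfl
  rw [h1, h2, h3]; ring

variable {c m2 : ℝ}

/-- PART Ͱ-d's Dirichlet form in this file's letters: `Re⟨v, M_Uv⟩ = m²Σ_x‖v_x‖² + cΣ_xΣ_μ bondE(x,μ)`. [cite: Balaban1985BackgroundPropagators, (3.23) p.394; King1986, (4.4) p.670] -/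
theorem re_quadForm_covLapF_eq_bondE (c m2 : ℝ) {U : Tor K × Fin (d + 1) → Matrix n n 𝕜} (hU : ∀ b, U b ∈ Matrix.unitaryGroup n 𝕜) (v : Tor K × n → 𝕜) :
    RCLike.re (star v ⬝ᵥ (covLapF K c m2 U *ᵥ v)) = m2 * ∑ x, ‖fib K v x‖ ^ 2 + c * ∑ x, ∑ μ, bondE K U v x μ :=
  re_quadForm_covLapF K c m2 hU v

/-- ★★ THE SUMMED PLAQUETTE BOUND: `Σ_x plaqE(x,μ,ν) ≥ 4λ(γ)·Σ_x‖v_x‖²` under the numerical-range bound on the `(μ,ν)`-plaquettes. [cite: DodziukMathai2006, Cor 1.3 §1; King1986, (2.12) p.653] -/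
theorem sum_plaqE_ge {U : Tor K × Fin (d + 1) → Matrix n n 𝕜} (hU : ∀ b, U b ∈ Matrix.unitaryGroup n 𝕜) (v : Tor K × n → 𝕜) (μ ν : Fin (d + 1)) {γ : ℝ}
    (hγ : ∀ x, ∀ u : EuclideanSpace 𝕜 n, RCLike.re ⟪u, Matrix.toEuclideanLin (kingPlaq K U x μ ν) u⟫_𝕜 ≤ γ * ‖u‖ ^ 2) :
    4 * plaqGap γ * ∑ x, ‖fib K v x‖ ^ 2 ≤ ∑ x, plaqE K U v x μ ν := by
  rw [mul_comm (4 : ℝ), mul_assoc, ← sum_corner_mass_eq K v μ ν, Finset.mul_sum]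
  exact Finset.sum_le_sum fun x _ => plaqE_ge K hU v x μ ν (hγ x)

end Sums

/-! ## §3 Plaquette coercivity of `−cΔ_U + m²` -/

section Coercive

variable [hK : ∀ μ, NeZero (K μ)] {c m2 : ℝ}

/-- ★★★ **PLAQUETTE COERCIVITY (one orientation)**: for `c ≥ 0`, a unitary link field `U` and `ν₀ ≠ ν₁` with `Re⟪u, P_U(x,ν₀,ν₁)u⟫ ≤ γ‖u‖²` at EVERY site `x`:
`(m² + 2c·λ(γ))·Σ_x‖v_x‖² ≤ Re⟨v, (−cΔ_U+m²)v⟩`, `λ(γ) = 2−√(2+√(2+2γ))` (`= 2−2cos(θ∕4)` for plaquette angle `θ`): the bonds of directions `ν₀, ν₁` carry half the summed plaquette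
energy, and each plaquette is coercive by Ϳ-a — CURVATURE BOUNDED BELOW GENERATES A MASS `2cλ(γ)`, for every fibre dimension and every (non-abelian) gauge group.
[cite: DodziukMathai2006, Cor 1.3 §1; Balaban1985BackgroundPropagators, (3.23) p.394; King1986, (4.4) p.670] -/
theorem re_quadForm_covLapF_ge_plaq (hc : 0 ≤ c) (m2 : ℝ) {U : Tor K × Fin (d + 1) → Matrix n n 𝕜} (hU : ∀ b, U b ∈ Matrix.unitaryGroup n 𝕜) {ν₀ ν₁ : Fin (d + 1)} (hν : ν₀ ≠ ν₁)
    {γ : ℝ} (hγ : ∀ x, ∀ u : EuclideanSpace 𝕜 n, RCLike.re ⟪u, Matrix.toEuclideanLin (kingPlaq K U x ν₀ ν₁) u⟫_𝕜 ≤ γ * ‖u‖ ^ 2) (v : Tor K × n → 𝕜) :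
    (m2 + 2 * c * plaqGap γ) * ∑ x, ‖fib K v x‖ ^ 2 ≤ RCLike.re (star v ⬝ᵥ (covLapF K c m2 U *ᵥ v)) := by
  rw [re_quadForm_covLapF_eq_bondE K c m2 hU v]
  -- keep only the bonds of directions ν₀, ν₁
  have hdrop : ∑ x, bondE K U v x ν₀ + ∑ x, bondE K U v x ν₁ ≤ ∑ x, ∑ μ, bondE K U v x μ := by
    rw [← Finset.sum_add_distrib]
    refine Finset.sum_le_sum fun x _ => ?_
    rw [← Finset.sum_pair hν]
    exact Finset.sum_le_sum_of_subset_of_nonneg (Finset.subset_univ _) fun μ _ _ => bondE_nonneg K U v x μ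
  have hpl := sum_plaqE_ge K hU v ν₀ ν₁ hγ
  rw [sum_plaqE_eq] at hpl
  have hsum0 : 0 ≤ ∑ x, ‖fib K v x‖ ^ 2 := Finset.sum_nonneg fun _ _ => sq_nonneg _
  have h3 : c * (2 * plaqGap γ * ∑ x, ‖fib K v x‖ ^ 2) ≤ c * ∑ x, ∑ μ, bondE K U v x μ :=
    mul_le_mul_of_nonneg_left (by linarith) hc
  linarith

/-- ★★★ **PLAQUETTE COERCIVITY (all orientations)**: if `d ≥ 1` and the numerical-range bound holds for the plaquettes of EVERY ordered pair `μ ≠ ν` at every site, then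
`(m² + (d+1)c·λ(γ))·Σ_x‖v_x‖² ≤ Re⟨v, (−cΔ_U+m²)v⟩` (each direction lies in `2d` ordered pairs: `2d·Σ_μE_μ = Σ_{μ≠ν}(E_μ+E_ν) ≥ d(d+1)·2λ‖v‖²`).
[cite: DodziukMathai2006, Cor 1.3 §1; Balaban1985BackgroundPropagators, (3.23) p.394; King1986, (4.4) p.670] -/
theorem re_quadForm_covLapF_ge_plaq_all (hd : 0 < d) (hc : 0 ≤ c) (m2 : ℝ) {U : Tor K × Fin (d + 1) → Matrix n n 𝕜} (hU : ∀ b, U b ∈ Matrix.unitaryGroup n 𝕜) {γ : ℝ}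
    (hγ : ∀ μ ν, μ ≠ ν → ∀ x, ∀ u : EuclideanSpace 𝕜 n, RCLike.re ⟪u, Matrix.toEuclideanLin (kingPlaq K U x μ ν) u⟫_𝕜 ≤ γ * ‖u‖ ^ 2) (v : Tor K × n → 𝕜) :
    (m2 + ((d : ℝ) + 1) * c * plaqGap γ) * ∑ x, ‖fib K v x‖ ^ 2 ≤ RCLike.re (star v ⬝ᵥ (covLapF K c m2 U *ᵥ v)) := by
  rw [re_quadForm_covLapF_eq_bondE K c m2 hU v]
  set E : Fin (d + 1) → ℝ := fun μ => ∑ x, bondE K U v x μ with hE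
  set N : ℝ := ∑ x, ‖fib K v x‖ ^ 2 with hN
  have hswap : ∑ x, ∑ μ, bondE K U v x μ = ∑ μ, E μ := by rw [hE]; exact Finset.sum_comm
  -- each ordered pair gives `E μ + E ν ≥ 2λN`
  have hpair : ∀ μ ν, μ ≠ ν → 2 * plaqGap γ * N ≤ E μ + E ν := fun μ ν hμν => by
    have hpl := sum_plaqE_ge K hU v μ ν (hγ μ ν hμν)
    rw [sum_plaqE_eq] at hpl
    show 2 * plaqGap γ * N ≤ ∑ x, bondE K U v x μ + ∑ x, bondE K U v x ν
    linarith
  -- sum over ordered pairs: `Σ_μ Σ_{ν ≠ μ} (E μ + E ν) = 2d·Σ_μ E μ`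
  have hcount : ∑ μ : Fin (d + 1), ∑ ν ∈ Finset.univ.erase μ, (E μ + E ν) = 2 * (d : ℝ) * ∑ μ, E μ := by
    have h1 : ∀ μ : Fin (d + 1), ∑ ν ∈ Finset.univ.erase μ, (E μ + E ν) = (d : ℝ) * E μ + (∑ ν, E ν - E μ) := fun μ => by
      rw [Finset.sum_add_distrib, Finset.sum_const, Finset.card_erase_of_mem (Finset.mem_univ μ), Finset.card_univ, Fintype.card_fin, Nat.add_sub_cancel,
        nsmul_eq_mul, Finset.sum_erase_eq_sub (Finset.mem_univ μ)]
    simp only [h1, Finset.sum_add_distrib, Finset.sum_sub_distrib, Finset.sum_const, Finset.card_univ, Fintype.card_fin, nsmul_eq_mul, ← Finset.mul_sum]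
    push_cast; ring
  have hlow : ∑ μ : Fin (d + 1), ∑ ν ∈ Finset.univ.erase μ, (E μ + E ν) ≥ ∑ μ : Fin (d + 1), ∑ ν ∈ Finset.univ.erase μ, 2 * plaqGap γ * N :=
    Finset.sum_le_sum fun μ _ => Finset.sum_le_sum fun ν hν => hpair μ ν (Ne.symm (Finset.ne_of_mem_erase hν))
  have hconst : ∑ μ : Fin (d + 1), ∑ ν ∈ Finset.univ.erase μ, 2 * plaqGap γ * N = ((d : ℝ) + 1) * d * (2 * plaqGap γ * N) := by
    simp only [Finset.sum_const, Finset.card_erase_of_mem (Finset.mem_univ _), Finset.card_univ, Fintype.card_fin, Nat.add_sub_cancel, nsmul_eq_mul]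
    push_cast; ring
  rw [hcount] at hlow
  rw [hconst] at hlow
  have hd' : (0 : ℝ) < d := by exact_mod_cast hd
  have hEsum : ((d : ℝ) + 1) * plaqGap γ * N ≤ ∑ μ, E μ := by
    have := hlow.le
    nlinarith
  rw [hswap]
  have h3 : c * (((d : ℝ) + 1) * plaqGap γ * N) ≤ c * ∑ μ, E μ := mul_le_mul_of_nonneg_left hEsum hc
  show (m2 + ((d : ℝ) + 1) * c * plaqGap γ) * N ≤ m2 * N + c * ∑ μ, E μ
  linarith

end Coercive

/-! ## §4 Spectral corollaries: eigenvalues, invertibility of the massless operator, `‖G_U‖` -/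

section Spectral

variable [hK : ∀ μ, NeZero (K μ)] {c m2 : ℝ}

/-- The coercive bound in `ℓ²` norm: `(m² + 2cλ)‖v‖² ≤ Re⟨v, M_Uv⟩`. [cite: DodziukMathai2006, Cor 1.3 §1] -/
theorem re_quadForm_covLapF_ge_plaq_norm (hc : 0 ≤ c) (m2 : ℝ) {U : Tor K × Fin (d + 1) → Matrix n n 𝕜} (hU : ∀ b, U b ∈ Matrix.unitaryGroup n 𝕜) {ν₀ ν₁ : Fin (d + 1)} (hν : ν₀ ≠ ν₁)
    {γ : ℝ} (hγ : ∀ x, ∀ u : EuclideanSpace 𝕜 n, RCLike.re ⟪u, Matrix.toEuclideanLin (kingPlaq K U x ν₀ ν₁) u⟫_𝕜 ≤ γ * ‖u‖ ^ 2) (v : Tor K × n → 𝕜) :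
    (m2 + 2 * c * plaqGap γ) * ‖(toLp 2 v : EuclideanSpace 𝕜 (Tor K × n))‖ ^ 2 ≤ RCLike.re (star v ⬝ᵥ (covLapF K c m2 U *ᵥ v)) := by
  rw [← sum_norm_fib_sq]
  exact re_quadForm_covLapF_ge_plaq K hc m2 hU hν hγ v

/-- ★★ **EVERY EIGENVALUE of `−cΔ_U+m²` is `≥ m² + 2c·λ(γ)`** under the one-orientation plaquette bound (Ͱ-f's `≥ m²` sharpened by the curvature term).
[cite: DodziukMathai2006, Cor 1.3 §1; King1986, (4.4) p.670] -/
theorem eigenvalues_covLapF_ge_plaq (hc : 0 ≤ c) (m2 : ℝ) {U : Tor K × Fin (d + 1) → Matrix n n 𝕜} (hU : ∀ b, U b ∈ Matrix.unitaryGroup n 𝕜) {ν₀ ν₁ : Fin (d + 1)} (hν : ν₀ ≠ ν₁)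
    {γ : ℝ} (hγ : ∀ x, ∀ u : EuclideanSpace 𝕜 n, RCLike.re ⟪u, Matrix.toEuclideanLin (kingPlaq K U x ν₀ ν₁) u⟫_𝕜 ≤ γ * ‖u‖ ^ 2) (i : Tor K × n) :
    m2 + 2 * c * plaqGap γ ≤ (isHermitian_covLapF K c m2 U).eigenvalues i := by
  set hA := isHermitian_covLapF K c m2 U
  rw [hA.eigenvalues_eq i]
  have h := re_quadForm_covLapF_ge_plaq_norm K hc m2 hU hν hγ (⇑(hA.eigenvectorBasis i))
  have hnorm : ‖(toLp 2 (⇑(hA.eigenvectorBasis i)) : EuclideanSpace 𝕜 (Tor K × n))‖ = 1 := hA.eigenvectorBasis.orthonormal.1 i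
  rwa [hnorm, one_pow, mul_one] at h

/-- ★★ **POSITIVE DEFINITENESS FROM CURVATURE**: if `m² + 2c·λ(γ) > 0` then `−cΔ_U + m² ≻ 0` — in particular the MASSLESS covariant Laplacian (`m² = 0`, `c > 0`) is positive definite at
every field whose `(ν₀,ν₁)`-plaquettes are uniformly non-flat (`γ < 1`). [cite: DodziukMathai2006, Cor 1.3 §1; Balaban1985BackgroundPropagators, (3.23) p.394] -/
theorem posDef_covLapF_of_plaq (hc : 0 ≤ c) {m2 : ℝ} {U : Tor K × Fin (d + 1) → Matrix n n 𝕜} (hU : ∀ b, U b ∈ Matrix.unitaryGroup n 𝕜) {ν₀ ν₁ : Fin (d + 1)} (hν : ν₀ ≠ ν₁)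
    {γ : ℝ} (hγ : ∀ x, ∀ u : EuclideanSpace 𝕜 n, RCLike.re ⟪u, Matrix.toEuclideanLin (kingPlaq K U x ν₀ ν₁) u⟫_𝕜 ≤ γ * ‖u‖ ^ 2) (hpos : 0 < m2 + 2 * c * plaqGap γ) :
    (covLapF K c m2 U).PosDef := by
  refine PosDef.of_dotProduct_mulVec_pos (isHermitian_covLapF K c m2 U) fun v hv => ?_
  have h := re_quadForm_covLapF_ge_plaq_norm K hc m2 hU hν hγ v
  have hvn : 0 < ‖(toLp 2 v : EuclideanSpace 𝕜 (Tor K × n))‖ ^ 2 := by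
    have : (toLp 2 v : EuclideanSpace 𝕜 (Tor K × n)) ≠ 0 := fun h0 => hv (by simpa using congrArg ofLp h0)
    positivity
  exact RCLike.pos_iff.mpr ⟨lt_of_lt_of_le (mul_pos hpos hvn) h, im_quadForm_covLapF K c m2 U v⟩

/-- `IsUnit (−cΔ_U+m²)` under the same hypotheses (so the covariance `G_U = (−cΔ_U+m²)⁻¹` exists, also at `m² = 0`). [cite: Balaban1985BackgroundPropagators, (3.23) p.394] -/
theorem isUnit_covLapF_of_plaq (hc : 0 ≤ c) {m2 : ℝ} {U : Tor K × Fin (d + 1) → Matrix n n 𝕜} (hU : ∀ b, U b ∈ Matrix.unitaryGroup n 𝕜) {ν₀ ν₁ : Fin (d + 1)} (hν : ν₀ ≠ ν₁)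
    {γ : ℝ} (hγ : ∀ x, ∀ u : EuclideanSpace 𝕜 n, RCLike.re ⟪u, Matrix.toEuclideanLin (kingPlaq K U x ν₀ ν₁) u⟫_𝕜 ≤ γ * ‖u‖ ^ 2) (hpos : 0 < m2 + 2 * c * plaqGap γ) :
    IsUnit (covLapF K c m2 U) :=
  (posDef_covLapF_of_plaq K hc hU hν hγ hpos).isUnit

/-- ★★★ **`‖G_Uw‖ ≤ (m² + 2cλ(γ))⁻¹‖w‖`**: with `v = G_Uw`, `(m²+2cλ)‖v‖² ≤ Re⟨v, M_Uv⟩ = Re⟨v, w⟩ ≤ ‖v‖‖w‖`. [cite: DodziukMathai2006, Cor 1.3 §1; Balaban1985BackgroundPropagators, (3.39) p.397] -/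
theorem norm_toLp_inv_mulVec_le_of_plaq (hc : 0 ≤ c) {m2 : ℝ} {U : Tor K × Fin (d + 1) → Matrix n n 𝕜} (hU : ∀ b, U b ∈ Matrix.unitaryGroup n 𝕜) {ν₀ ν₁ : Fin (d + 1)}
    (hν : ν₀ ≠ ν₁) {γ : ℝ} (hγ : ∀ x, ∀ u : EuclideanSpace 𝕜 n, RCLike.re ⟪u, Matrix.toEuclideanLin (kingPlaq K U x ν₀ ν₁) u⟫_𝕜 ≤ γ * ‖u‖ ^ 2)
    (hpos : 0 < m2 + 2 * c * plaqGap γ) (w : Tor K × n → 𝕜) :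
    ‖(toLp 2 ((covLapF K c m2 U)⁻¹ *ᵥ w) : EuclideanSpace 𝕜 (Tor K × n))‖ ≤ (m2 + 2 * c * plaqGap γ)⁻¹ * ‖(toLp 2 w : EuclideanSpace 𝕜 (Tor K × n))‖ := by
  set κ := m2 + 2 * c * plaqGap γ with hκ
  set v := (covLapF K c m2 U)⁻¹ *ᵥ w with hv
  have hdet : IsUnit (covLapF K c m2 U).det := (Matrix.isUnit_iff_isUnit_det _).mp (isUnit_covLapF_of_plaq K hc hU hν hγ hpos)
  have hMv : covLapF K c m2 U *ᵥ v = w := by rw [hv, mulVec_mulVec, Matrix.mul_nonsing_inv _ hdet, one_mulVec]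
  have h1 := re_quadForm_covLapF_ge_plaq_norm K hc m2 hU hν hγ v
  rw [hMv] at h1
  have h2 := re_star_dotProduct_le_norm_mul_norm K v w
  set a := ‖(toLp 2 v : EuclideanSpace 𝕜 (Tor K × n))‖ with ha
  set b := ‖(toLp 2 w : EuclideanSpace 𝕜 (Tor K × n))‖ with hb
  have ha0 : 0 ≤ a := norm_nonneg _
  have hb0 : 0 ≤ b := norm_nonneg _
  rw [le_inv_mul_iff₀ hpos]
  by_cases hz : a = 0
  · rw [hz, mul_zero]; exact hb0
  · have hapos : 0 < a := lt_of_le_of_ne ha0 (Ne.symm hz)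
    nlinarith [h1, h2]

open scoped Matrix.Norms.L2Operator in
/-- ★★★ **`‖(−cΔ_U+m²)⁻¹‖_{ℓ²→ℓ²} ≤ (m² + 2c·λ(γ))⁻¹`** — uniformly in the volume and in `U` within the class of fields with uniformly non-flat `(ν₀,ν₁)`-plaquettes; at `m² = 0` the
massless covariance is bounded by the INVERSE CURVATURE MASS `(2cλ(γ))⁻¹`. [cite: DodziukMathai2006, Cor 1.3 §1; Balaban1985BackgroundPropagators, (3.39) p.397] -/
theorem l2_opNorm_covLapF_inv_le_of_plaq (hc : 0 ≤ c) {m2 : ℝ} {U : Tor K × Fin (d + 1) → Matrix n n 𝕜} (hU : ∀ b, U b ∈ Matrix.unitaryGroup n 𝕜) {ν₀ ν₁ : Fin (d + 1)} (hν : ν₀ ≠ ν₁)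
    {γ : ℝ} (hγ : ∀ x, ∀ u : EuclideanSpace 𝕜 n, RCLike.re ⟪u, Matrix.toEuclideanLin (kingPlaq K U x ν₀ ν₁) u⟫_𝕜 ≤ γ * ‖u‖ ^ 2) (hpos : 0 < m2 + 2 * c * plaqGap γ) :
    ‖(covLapF K c m2 U)⁻¹‖ ≤ (m2 + 2 * c * plaqGap γ)⁻¹ := by
  rw [Matrix.cstar_norm_def]
  refine ContinuousLinearMap.opNorm_le_bound _ (inv_nonneg.2 hpos.le) fun w => ?_
  have hw : w = toLp 2 (ofLp w) := rfl
  rw [hw, Matrix.toEuclideanCLM_toLp]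
  exact norm_toLp_inv_mulVec_le_of_plaq K hc hU hν hγ hpos (ofLp w)

end Spectral

end Summit.QuantumFields.YangMills.BalabanUVNodes.N15KingModelRung.Curvature

end
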